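import Mathlib
import Literature.NumberTheory.LFunctions.RHWave0GRHProofs
import Literature.NumberTheory.QuadraticFields.KroneckerCharacterFourProofs
import Literature.NumberTheory.Sieve.JurkatRichertRefutation
import Literature.Computability.MetaComplexity.AvgPLevinOfAvgP
import HarnessLib

/-!
# GRHCharacterPrimeSums

Topic `Literature/NumberTheory/LFunctions`. Named literature fact(s) relocated by the gate from `Summits/QuantumAdvantage/QuantumAdvantage/Theorems/MobiusLadderLiouvilleNotPPolyTwinFreeGRH.lean`
(accept-time relocation of `[cite]`d propositions written inline in a Summits proposal; human ruling 2026-08-15).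
Sources: MontgomeryVaughan2007.

* `Literature.NumberTheory.LFunctions.grh_primeCharSum_le`
-/

namespace Literature.NumberTheory.LFunctions

open Filter Finset Real Topology

/-- **The prime number theorem for characters under GRH (Titchmarsh 1930), as printed in
Montgomery–Vaughan, Theorem 13.7, eq. (13.21)**: let `q` be given and suppose that GRH holds for
all `L`-functions modulo `q`; then for `x ≥ 2`, `π(x, χ) = E₀(χ) li(x) + O(x^{1/2} log qx)`, where
`π(x, χ) = ∑_{p ≤ x} χ(p)` and `E₀(χ) = 1` or `0` according as `χ = χ₀` or not (implicit constant
absolute). Stated for non-principal `χ` (`E₀ = 0`), with GRH modulo `q` in the tree's strip form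
`DirichletCharacter.RiemannHypothesis`.
-- TODO(general form): the principal case `π(x, χ₀) = li(x) + O(x^{1/2} log qx)` and (13.19)–(13.20) for `ψ`, `ϑ`.
[cite: MontgomeryVaughan2007, §13.1 Thm. 13.7 eq. (13.21)] [file NumberTheory/LFunctions/GRHCharacterPrimeSums] -/
def grh_primeCharSum_le : Prop :=
  ∃ C : ℝ, ∀ (q : ℕ) [NeZero q], (∀ χ : DirichletCharacter ℂ q, χ.RiemannHypothesis) →
    ∀ χ : DirichletCharacter ℂ q, χ ≠ 1 → ∀ x : ℝ, 2 ≤ x →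
      ‖∑ p ∈ (Finset.Iic ⌊x⌋₊).filter Nat.Prime, χ p‖ ≤ C * x ^ (1 / 2 : ℝ) * Real.log (q * x)

end Literature.NumberTheory.LFunctions
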